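import Summits.BirchSwinnertonDyer.BirchSwinnertonDyer.Theorems.SignedLowerHalvesSharpFlatCharValueRankZeroAllLevelsCount
import Summits.BirchSwinnertonDyer.BirchSwinnertonDyer.Theorems.SignedLowerHalvesSharpFlatCharValueRankZeroAllLevelsLocalLift
import Summits.BirchSwinnertonDyer.BirchSwinnertonDyer.Theses.SignedLowerHalves
import Literature.NumberTheory.EllipticCurves.Sprung2024.ChromaticCharValueRankZeroProofs
import HarnessLib

/-!
# Sprung 2024 §5.2 Lemma 5.5 (all conductors), BOTH colours, and the route input
# `SignedLowerHalves.SharpFlatCharValueRankZeroAllLevels` (= `Sprung2024.lem59AllN` = `PrintX8VS.InputLem59AllN`)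
# FROM THREE NAMED FACTS OF GREENBERG LNM 1716 / KATO BY NAME: Prop. 4.13 (Cassels), Prop. 4.12, §5 p. 140
# (Kato Thm. 12.4) — the flagged input «Sprung 2024 Lemma 5.5 for every `N`» is no longer needed by name

Cell `bsd-inputs` (D-0154 (2) INPUTS→UNCONDITIONAL), seat `bsd-inputs-l55-p1` (row 8, T3(i)); serves item
stmt-BirchSwinnertonDyer-19878 (`Sprung2024.lem59AllN_sharpFlatCharValue_rankZero` = Sprung 2024 §5.2 Lemmas 5.5 ·
5.8 · 5.9 multiplied, all `N`; route decls `SignedLowerHalves.SharpFlatCharValueRankZeroAllLevels` (support 503),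
`PrintX8VS.InputLem59AllN` (support 906)). Sequel of `…SharpFlatCharValueRankZeroAllLevels{Count,ColemanKer,LocalLift}.lean`.

STATE OF THE CHAIN. After the kdot seat (`Sprung2024/Chromatic*Proofs`: Lemmas 5.8, 5.9, 5.5 (`v = p`), 5.6,
Sprung 2012 Props. 7.3/7.6, Lemma 2.3 — kernel theorems; `lem59AllN_of_lem55AllNcard_of_prop73_prop76`) the item's
single residual was the named fact `Sprung2024.lem55AllN_sharpFlat_coinvariants_card` (Lemma 5.5 for every `N`:
`#ker g · #E(ℚ)_p = p^{ord_p ∏ c_ℓ} · #(Sel⋆(E/ℚ_∞))_Γ`), whose printed proof is Greenberg's Lemma 4.7 with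
`Sel ↦ Sel⋆`: Cassels–Poitou–Tate (Prop. 4.13), Prop. 4.12, the corank count pp. 119–120, the local surjectivity
p. 108, and weak Leopoldt p. 140 — global/local Tate duality and Kato's Thm. 12.4, of which only pp. 108 and
119–120 are theorems of the tree. THIS FILE finishes the odd-`p` port of the bsd-2adic COUNT♭@2 door:

* `hlocp_of_isHondaSystem` — the `⋆`-local lift at the place above `p` (the displayed `hlocp` of the door
  `sharpFlatCount_of_print_of_locp`), EITHER colour, discharged for a genuine Honda system at an odd
  supersingular prime (`exists_localLift_chromatic` + kdot's «`Ker Col⋆` kills `E(ℚ_p)`» + Lemma 2.3);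
* `sharpFlatCount_of_print` — Lemma 5.5 (all `N`) at `(W, p, ⋆)`, both colours, ⟸ the three named facts;
* `lem55AllN_of_greenberg : casselsSurjectivity_H1Sigma ℚ → prop412_noFiniteSubmodule_H1Sigma_of_rank_one →
  h1SigmaInfty_rank_eq_one → Sprung2024.lem55AllN_sharpFlat_coinvariants_card` (and the printed square-free
  form `lem55_of_greenberg`);
* `lem59AllN_of_greenberg`, `lem59_of_greenberg` — Sprung 2024 §5.2 (Lemmas 5.5 · 5.8 · 5.9 multiplied) ⟸ the
  three named facts (Props. 7.3/7.6 by `prop73/76_…_holds`);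
* BY NAME: `sharpFlatCharValueRankZeroAllLevels_of_greenberg :
  hC → h412 → hWL → SignedLowerHalves.SharpFlatCharValueRankZeroAllLevels`. (Route `PrintX8VS`'s
  `InputLem59AllN` has the same body `Sprung2024.lem59AllN_…`, so `lem59AllN_of_greenberg` serves it verbatim; its
  Theses file is not imported here because its import closure reaches a route file under active editing.)

NET EFFECT ON THE INPUT LEDGER (D-0154 (2)): wherever routes X8VS / SignedLowerHalves display item 19878
(`Sprung2024.lem59AllN_…`, PUB*, flag `Sprung24-§5.2-allN-via-RaySprung25` — the one soft attribution joint of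
the item), they may instead display the THREE flag-free refereed statements
{`Greenberg1999.casselsSurjectivity_H1Sigma ℚ` (LNM 1716 Prop. 4.13 / Cassels 1964),
`Greenberg1999.prop412_noFiniteSubmodule_H1Sigma_of_rank_one` (LNM 1716 Prop. 4.12),
`Greenberg1999.h1SigmaInfty_rank_eq_one` (LNM 1716 §5 p. 140 = Kato Astérisque 295 Thm. 12.4)} — the same
three the K4/TP2 doors at `p = 2` already display (`SSFlatEC.flatCountTwo_of_print3`). HONEST FRAMING:
theorems only; CONDITIONAL on those three existing named facts; item 19878 is NOT closed (no unconditional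
`_holds` — that needs Poitou–Tate duality in the tree); no summit statement is proved; no census cell moves;
BSD is not proved by any of this.

References: [Sprung2024] §5.2 Lemmas 5.5–5.9 and Proof of Thm. 5.3 (pp. 39–41); [RaySprung2025] p. 2343;
[GreenbergLNM1716] §4 pp. 104–108 (Lemmas 4.3–4.7), Appendix Prop. 4.12, Prop. 4.13 / p. 122, pp. 119–120,
§5 p. 140; [Kato2004Asterisque] Thm. 12.4; [Sprung2012] Thm. 2.2, Lemma 2.3, Props. 7.3/7.6, Def. 7.9–7.11;
[Cassels1964ArithmeticVII].
-/

set_option autoImplicit false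
-- the Theorems namespace of this sub repeats the summit name by design (D-0017 nested layout)
set_option linter.dupNamespace false

noncomputable section

open scoped Classical NumberField

open NumberField IsDedekindDomain

namespace Summit.BirchSwinnertonDyer.BirchSwinnertonDyer.Theorems.SharpFlatCount

open Literature.NumberTheory.EllipticCurves Literature.NumberTheory.GaloisRepresentations
  WeierstrassCurve ZpExtension Literature.NumberTheory.EllipticCurves.Kobayashi2003
  Literature.NumberTheory.EllipticCurves.Sprung2017 Literature.NumberTheory.EllipticCurves.Sprung2012
  Literature.NumberTheory.EllipticCurves.Sprung2024 Literature.NumberTheory.EllipticCurves.IwasawaDual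
  Literature.NumberTheory.EllipticCurves.IwasawaAlgebra Literature.NumberTheory.EllipticCurves.GreenbergVatsal2000
  Literature.NumberTheory.EllipticCurves.Rank1Residual Summit.BirchSwinnertonDyer.Rank1Residual.X5.O1
  Summit.BirchSwinnertonDyer.Rank1Residual.X2
  Summit.BirchSwinnertonDyer.BirchSwinnertonDyer.Theorems.SSFlatEC

/-! ## §1 The `⋆`-local lift at `p` for a genuine Honda system, either colour -/

variable (W : WeierstrassCurve ℚ) [W.IsElliptic] [W.IsGloballyMinimal] (p : ℕ) [Fact p.Prime]

/-- **LOC⋆ at the place above `p` for a genuine Honda system, odd `p`, EITHER colour** — the hypothesis `hlocp`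
of `sharpFlatCount_of_print_of_locp`, DISCHARGED: the place `w ∋ p` is `v`, Lemma 2.3 is
`lem23_localTowerPoints_noPTorsion_holds`, the levels and the `n ≥ 1` trace relation come from `IsHondaSystem`,
«`Ker Col⋆` kills `E(ℚ_p)`» is `colemanKer_apply_eq_zero_of_mem_localLayerPointsOfEmb_zero` (both colours), the
`⋆` lift is `exists_localLift_chromatic`, and the classical clause follows from the `⋆` one (`E⋆ ≤ Kummer ≤ 𝒦_w`).
[cite: GreenbergLNM1716, §4 proof of Lemma 4.7 (p. 108)] [cite: Sprung2012, Def. 7.9, Lemma 7.10, Lemma 2.3, Thm. 2.2]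
[cite: Sprung2024, §5.2 p. 39 (E⋆_{0,p} = E(ℚ_p) ⊗ ℚ_p/ℤ_p)] -/
theorem hlocp_of_isHondaSystem (hp2 : p ≠ 2) (hgoodp : W.HasGoodReductionAtPrime p)
    (hap : (p : ℤ) ∣ W.frobeniusTrace p) (κ : ZpExtension ℚ p) (hκ : κ.IsCyclotomic)
    {v : HeightOneSpectrum (𝓞 ℚ)} (hv : (p : 𝓞 ℚ) ∈ v.asIdeal)
    {g : Field.absoluteGaloisGroup (v.adicCompletion ℚ)}
    (hg : κ.IsTopGenerator (resGalOfEmb (closureEmb (K := ℚ) (v.adicCompletion ℚ)) g))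
    {cneg : localPoints W (v.adicCompletion ℚ)} {c : ℕ → localPoints W (v.adicCompletion ℚ)}
    (hH : IsHondaSystem κ (closureEmb (K := ℚ) (v.adicCompletion ℚ)) W (W.frobeniusTrace p) g cneg c)
    (col : Chroma) (S₀ : Finset (HeightOneSpectrum (𝓞 ℚ))) :
    ∀ t ∈ unramifiedOutside κ.kerSubgroup (W.geomPrimaryTorsion p) p
        (↑S₀ : Set (HeightOneSpectrum (𝓞 ℚ))),
      (∀ σ : Field.absoluteGaloisGroup ℚ, W.conjH1 p κ.kerSubgroup σ t - t ∈
        sharpFlatSelmerInfty W κ (closureEmb (K := ℚ) (v.adicCompletion ℚ)) (W.frobeniusTrace p) g c col) →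
      ∀ w : HeightOneSpectrum (𝓞 ℚ), ((p : ℕ) : 𝓞 ℚ) ∈ w.asIdeal →
      ∃ xw : discreteH1 (localSubgroup (⊤ : Subgroup (Field.absoluteGaloisGroup ℚ)) (w.adicCompletion ℚ))
          (localPoints W (w.adicCompletion ℚ)),
        (∃ k : ℕ, p ^ k • xw = 0) ∧
        ∀ y : W.subgroupH1 p (⊤ : Subgroup (Field.absoluteGaloisGroup ℚ)),
          W.localResOver p ⊤ (w.adicCompletion ℚ) y = xw →
          t - W.resOfLe p (le_top : κ.kerSubgroup ≤ ⊤) y ∈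
              W.localKerOver p κ.kerSubgroup (w.adicCompletion ℚ) ∧
          (w = v → t - W.resOfLe p (le_top : κ.kerSubgroup ≤ ⊤) y ∈
            sharpFlatLocalKummerOverOfEmb W p κ.kerSubgroup (closureEmb (K := ℚ) (v.adicCompletion ℚ))
              (localTowerPointsOfEmb κ (closureEmb (K := ℚ) (v.adicCompletion ℚ)) W)
              (colemanKer κ (closureEmb (K := ℚ) (v.adicCompletion ℚ)) W (W.frobeniusTrace p) g c col)) := by
  intro t _ hconj w hw
  have hwv : w = v :=
    HeightOneSpectrum.eq_of_natCast_mem_rat (Fact.out : p.Prime) hw (by exact_mod_cast hv)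
  subst hwv
  -- Lemma 2.3 (tree theorem)
  have hnt : ∀ P ∈ localTowerPointsOfEmb κ (closureEmb (K := ℚ) (w.adicCompletion ℚ)) W, p • P = 0 → P = 0 :=
    fun P hP hpP ↦ lem23_localTowerPoints_noPTorsion_holds W p hp2 hgoodp hap κ hκ w hv P hP hpP
  -- the Honda clauses used by the `p`-generic engine
  have hc : ∀ n, c n ∈ localLayerPointsOfEmb κ (closureEmb (K := ℚ) (w.adicCompletion ℚ)) W n := hH.2.1
  have hTr : ∀ n, 1 ≤ n → localTraceOfEmb κ (closureEmb (K := ℚ) (w.adicCompletion ℚ)) W n (n + 1)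
      (c (n + 1)) = W.frobeniusTrace p • c n - c (n - 1) := hH.2.2.2.2.1
  -- «`Ker Col⋆` kills `E(ℚ_p)`» (kdot theorem, both colours)
  have h𝒦 : ∀ z ∈ colemanKer κ (closureEmb (K := ℚ) (w.adicCompletion ℚ)) W (W.frobeniusTrace p) g c col,
      ∀ (x : localPoints W (w.adicCompletion ℚ))
        (hx : x ∈ localLayerPointsOfEmb κ (closureEmb (K := ℚ) (w.adicCompletion ℚ)) W 0),
        z ⟨x, localLayerPointsOfEmb_le_localTowerPointsOfEmb κ _ W 0 hx⟩ = 0 := fun z hz x hx ↦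
    colemanKer_apply_eq_zero_of_mem_localLayerPointsOfEmb_zero κ _ W hp2 hap hg hH col hz hx
  -- the `⋆`-condition on `conj_g t − t` (the `σ = 1` component of `Sel⋆_∞`)
  have hone : W.conjH1 p κ.kerSubgroup 1 = AddMonoidHom.id _ :=
    W.conjH1_of_mem_holds p κ.kerSubgroup (one_mem _)
  have ht : W.conjH1 p κ.kerSubgroup (resGalOfEmb (closureEmb (K := ℚ) (w.adicCompletion ℚ)) g) t - t ∈
      sharpFlatLocalKummerOverOfEmb W p κ.kerSubgroup (closureEmb (K := ℚ) (w.adicCompletion ℚ))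
        (localTowerPointsOfEmb κ (closureEmb (K := ℚ) (w.adicCompletion ℚ)) W)
        (colemanKer κ (closureEmb (K := ℚ) (w.adicCompletion ℚ)) W (W.frobeniusTrace p) g c col) := by
    have h := ((mem_sharpFlatSelmerInfty_iff W κ _ _ g c col _).1
      (hconj (resGalOfEmb (closureEmb (K := ℚ) (w.adicCompletion ℚ)) g))).2 1
    rwa [hone, AddMonoidHom.id_apply] at h
  -- the colour-generic part 19 (the instance `CharZero ℚ_w` is passed as a term)
  obtain ⟨xw, hxw, hmain⟩ := @exists_localLift_chromatic ℚ _ _ W _ p _ κ (w.adicCompletion ℚ) _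
    (charZero_adicCompletion w) _ (W.frobeniusTrace p) hap g hg c hc hTr hnt col h𝒦 t ht
  refine ⟨xw, hxw, fun y hy ↦ ⟨?_, fun _ ↦ hmain y hy⟩⟩
  exact localKummerOverOfEmb_le_localKerOverOfEmb _
    (sharpFlatLocalKummerOverOfEmb_le_localKummerOverOfEmb _ _ (hmain y hy))

/-! ## §2 Lemma 5.5 (all `N`), both colours, from the three named facts -/

/-- **Sprung 2024 Lemma 5.5 (all `N`) at `(W, p, ⋆)`, `p` odd supersingular, EITHER colour — from the THREE named
facts {Prop. 4.13 (Cassels), Prop. 4.12, Kato Thm. 12.4} and the kernel, NOTHING displayed.** (`Σ₀` is any finite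
set with good reduction off `Σ₀ ∪ {p}`; the conclusion does not mention it.)
[cite: Sprung2024, §5.2 Lemma 5.5 (p. 40)] [cite: GreenbergLNM1716, §4 Lemma 4.7, Prop. 4.12, Prop. 4.13 / p. 122; §5 p. 140]
[cite: Kato2004Asterisque, Thm. 12.4] -/
theorem sharpFlatCount_of_print (hp2 : p ≠ 2) (hgoodp : W.HasGoodReductionAtPrime p)
    (hap : (p : ℤ) ∣ W.frobeniusTrace p) (κ : ZpExtension ℚ p) (hκ : κ.IsCyclotomic)
    {γ : Field.absoluteGaloisGroup ℚ} (hγ : κ.IsTopGenerator γ)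
    {v : HeightOneSpectrum (𝓞 ℚ)} (hv : (p : 𝓞 ℚ) ∈ v.asIdeal)
    {g : Field.absoluteGaloisGroup (v.adicCompletion ℚ)}
    (hg : κ.IsTopGenerator (resGalOfEmb (closureEmb (K := ℚ) (v.adicCompletion ℚ)) g))
    {cneg : localPoints W (v.adicCompletion ℚ)} {c : ℕ → localPoints W (v.adicCompletion ℚ)}
    (hH : IsHondaSystem κ (closureEmb (K := ℚ) (v.adicCompletion ℚ)) W (W.frobeniusTrace p) g cneg c)
    (col : Chroma) (S₀ : Finset (HeightOneSpectrum (𝓞 ℚ)))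
    (hgood : ∀ w : HeightOneSpectrum (𝓞 ℚ), w ∉ S₀ → ((p : ℕ) : 𝓞 ℚ) ∉ w.asIdeal → W.HasGoodReductionAt w)
    (hC : Greenberg1999.casselsSurjectivity_H1Sigma ℚ)
    (h412 : Greenberg1999.prop412_noFiniteSubmodule_H1Sigma_of_rank_one)
    (hWL : Greenberg1999.h1SigmaInfty_rank_eq_one) :
    Finite (W.selmerGroupPInfty p) →
      Finite (EndCoinvariants (conjSharpFlatSelmerInfty W κ (closureEmb (K := ℚ) (v.adicCompletion ℚ))
        (W.frobeniusTrace p) g c col γ - 1)) →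
      Nat.card (↥((sharpFlatSelmerInfty W κ (closureEmb (K := ℚ) (v.adicCompletion ℚ))
            (W.frobeniusTrace p) g c col).comap (W.layerToInfty κ 0)) ⧸
          (W.selmerLayer κ 0).addSubgroupOf
            ((sharpFlatSelmerInfty W κ (closureEmb (K := ℚ) (v.adicCompletion ℚ))
              (W.frobeniusTrace p) g c col).comap (W.layerToInfty κ 0))) *
        Nat.card (MulAction.fixedPoints (Field.absoluteGaloisGroup ℚ) (W.geomPrimaryTorsion p)) =
      p ^ (padicValNat p W.tamagawaProduct) *
        Nat.card (EndCoinvariants (conjSharpFlatSelmerInfty W κ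
          (closureEmb (K := ℚ) (v.adicCompletion ℚ)) (W.frobeniusTrace p) g c col γ - 1)) :=
  sharpFlatCount_of_print_of_locp W p hp2 hgoodp hap κ hκ hγ hv hg hH col S₀ hgood hC h412 hWL
    (hlocp_of_isHondaSystem W p hp2 hgoodp hap κ hκ hv hg hH col S₀)

/-! ## §3 The named facts of Sprung 2024 §5.2 from the three named facts of Greenberg / Kato -/

/-- **Sprung 2024 §5.2 Lemma 5.5 for every conductor (`Sprung2024.lem55AllN_sharpFlat_coinvariants_card`) ⟸
Greenberg LNM 1716 Prop. 4.13 (Cassels), Prop. 4.12 and §5 p. 140 (Kato Thm. 12.4), by name.** `Σ₀ =` the set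
of primes of bad reduction (`W.badPlaces`, finite; none above the good prime `p`); the hypotheses `L(E,1) ≠ 0`
and `IsCyclotomicVariable` of the named fact are not used.
[cite: Sprung2024, §5.2 Lemma 5.5 (p. 40)] [cite: RaySprung2025, p. 2343]
[cite: GreenbergLNM1716, §4 Lemma 4.7 (pp. 107–108), Prop. 4.12, Prop. 4.13 / p. 122; §5 p. 140]
[cite: Kato2004Asterisque, Thm. 12.4] -/
theorem lem55AllN_of_greenberg (hC : Greenberg1999.casselsSurjectivity_H1Sigma ℚ)
    (h412 : Greenberg1999.prop412_noFiniteSubmodule_H1Sigma_of_rank_one)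
    (hWL : Greenberg1999.h1SigmaInfty_rank_eq_one) :
    Sprung2024.lem55AllN_sharpFlat_coinvariants_card := by
  intro W _ _ p _ hp2 hgoodp hap _hL κ γ hκ hγ _hX v hv g hg cneg c hH col hSel hco
  -- `Σ₀` = the bad places (none of them above `p`, since `p` is good)
  have hbad : (W.badPlaces (𝓞 ℚ)).Finite := W.finite_badPlaces_holds (𝓞 ℚ)
  have hSmem : ∀ w : HeightOneSpectrum (𝓞 ℚ), w ∈ hbad.toFinset ↔ ¬ W.HasGoodReductionAt w := fun w ↦ by
    simp only [Set.Finite.mem_toFinset, WeierstrassCurve.badPlaces, Set.mem_setOf_eq]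
  have hS : ∀ w : HeightOneSpectrum (𝓞 ℚ), w ∉ hbad.toFinset → ((p : ℕ) : 𝓞 ℚ) ∉ w.asIdeal →
      W.HasGoodReductionAt w := by
    intro w hw _
    by_contra hng
    exact hw ((hSmem w).mpr hng)
  exact sharpFlatCount_of_print W p hp2 hgoodp hap κ hκ hγ hv hg hH col hbad.toFinset hS hC h412 hWL hSel hco

/-- **Sprung 2024 §5.2 Lemma 5.5 as printed (square-free conductor; `Sprung2024.lem55_sharpFlat_coinvariants_card`)
⟸ the three named facts** (through the edge `lem55_sharpFlat_coinvariants_card_of_allN`).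
[cite: Sprung2024, §5.2 Lemma 5.5 (p. 40)] [cite: GreenbergLNM1716, §4 Lemma 4.7, Prop. 4.12, Prop. 4.13; §5 p. 140] -/
theorem lem55_of_greenberg (hC : Greenberg1999.casselsSurjectivity_H1Sigma ℚ)
    (h412 : Greenberg1999.prop412_noFiniteSubmodule_H1Sigma_of_rank_one)
    (hWL : Greenberg1999.h1SigmaInfty_rank_eq_one) :
    Sprung2024.lem55_sharpFlat_coinvariants_card :=
  lem55_sharpFlat_coinvariants_card_of_allN (lem55AllN_of_greenberg hC h412 hWL)

/-- **Sprung 2024 §5.2, Lemmas 5.5 · 5.8 · 5.9 multiplied, for every conductor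
(`Sprung2024.lem59AllN_sharpFlatCharValue_rankZero`, the item's signature) ⟸ the three named facts**: Lemma 5.5
from §3, Lemmas 5.8/5.9 and the `v = p` clause are kernel theorems (`lem59AllN_of_lem55AllNcard_of_prop73_prop76`
with `prop73/76_…_holds`). [cite: Sprung2024, §5.2 Lemmas 5.5, 5.8, 5.9 and Proof of Thm. 5.3 (pp. 40–41)]
[cite: RaySprung2025, p. 2343] [cite: GreenbergLNM1716, §4 Lemma 4.7, Prop. 4.12, Prop. 4.13; §5 p. 140]
[cite: Sprung2012, Prop. 7.3 (p. 1500), Prop. 7.6 (p. 1501)] -/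
theorem lem59AllN_of_greenberg (hC : Greenberg1999.casselsSurjectivity_H1Sigma ℚ)
    (h412 : Greenberg1999.prop412_noFiniteSubmodule_H1Sigma_of_rank_one)
    (hWL : Greenberg1999.h1SigmaInfty_rank_eq_one) :
    Sprung2024.lem59AllN_sharpFlatCharValue_rankZero :=
  lem59AllN_of_lem55AllNcard_of_prop73_prop76 (lem55AllN_of_greenberg hC h412 hWL)
    prop73_colemanFlat_surjective_holds prop76_colemanSharp_surjective_holds

/-- **Sprung 2024 §5.2 as printed (square-free conductor; `Sprung2024.lem59_sharpFlatCharValue_rankZero`) ⟸ the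
three named facts.** [cite: Sprung2024, §5.2 Proof of Thm. 5.3 (p. 41)]
[cite: GreenbergLNM1716, §4 Lemma 4.7, Prop. 4.12, Prop. 4.13; §5 p. 140] -/
theorem lem59_of_greenberg (hC : Greenberg1999.casselsSurjectivity_H1Sigma ℚ)
    (h412 : Greenberg1999.prop412_noFiniteSubmodule_H1Sigma_of_rank_one)
    (hWL : Greenberg1999.h1SigmaInfty_rank_eq_one) :
    Sprung2024.lem59_sharpFlatCharValue_rankZero :=
  lem59_of_lem55AllNcard_of_prop73_prop76 (lem55AllN_of_greenberg hC h412 hWL)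
    prop73_colemanFlat_surjective_holds prop76_colemanSharp_surjective_holds

/-! ## §4 The route decls BY NAME -/

/-- **Route `SignedLowerHalves`, support `SharpFlatCharValueRankZeroAllLevels` (item 19878) BY NAME ⟸ Greenberg
LNM 1716 Prop. 4.13 (Cassels), Prop. 4.12, §5 p. 140 (Kato Thm. 12.4).** CONDITIONAL on these three named facts;
does not close the item. [cite: Sprung2024, §5.2 (pp. 39–41)] [cite: GreenbergLNM1716, §4 Prop. 4.12, Prop. 4.13; §5 p. 140]
[cite: Kato2004Asterisque, Thm. 12.4] -/
theorem sharpFlatCharValueRankZeroAllLevels_of_greenberg (hC : Greenberg1999.casselsSurjectivity_H1Sigma ℚ)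
    (h412 : Greenberg1999.prop412_noFiniteSubmodule_H1Sigma_of_rank_one)
    (hWL : Greenberg1999.h1SigmaInfty_rank_eq_one) :
    Summit.BirchSwinnertonDyer.BirchSwinnertonDyer.Theses.SignedLowerHalves.SharpFlatCharValueRankZeroAllLevels :=
  lem59AllN_of_greenberg hC h412 hWL

end Summit.BirchSwinnertonDyer.BirchSwinnertonDyer.Theorems.SharpFlatCount

end
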